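import Literature.MathematicalPhysics.QuantumFieldTheory.Balaban1983to89.B9Eq326LocalPartDivergenceRow
import Literature.MathematicalPhysics.QuantumFieldTheory.Balaban1983to89.B9Eq342GreenPrimeTowerGradientRow
import Literature.MathematicalPhysics.QuantumFieldTheory.Balaban1983to89.B9Eq326LocalPartTowerZerothOrderCoshRow

/-!
# `Balaban1983to89.B9Eq326LocalPartTowerDivergenceRow` — T. Bałaban, *Propagators for lattice gauge theories in a background field*, Commun. Math. Phys.
# **99** (1985) 389–434 [Balaban1985BackgroundPropagators] Thm 3.1 (3.42) p. 397 SECOND ENTRY *«|(∇_U Gλ)(x)| ≤ B₀e^{−δ₀d(y,y′)}|λ|, x ∈ Δ(y), supp λ ⊂ Δ(y′)»*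
# read for the LOCAL PART `A₀ = Δ(U) + D_UD*_U + Q*aQ` of (3.26) p. 395 in its DIVERGENCE form, (3.8) p. 392, (3.23) p. 394, (3.49) p. 399, (3.69)–(3.73)
# pp. 404–405, with [Balaban1985Variational] (134)–(136) p. 298: **THE DIVERGENCE ROW OF THE TOWER LOCAL PART — for `A₀,k = Δ(U) + D_UD*_U + Q_k(U)†(a•Q_k(U))`
# on the bonds of the tower's fine torus `T_{(L^{n+1}m)}` and a source `f` supported over the bonds of ONE unit block `v` with `‖f(b)‖ ≤ F`:
# `‖(D*_U A₀,k⁻¹ f)(y)‖ ≤ 2e^{θ(L^{n+1}−1)}·(A + B·C_u)·F·e^{−κ·d_m(Πy, v)}` at EVERY fine site `y`, given the decayed value row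
# `‖(A₀,k⁻¹f)(b)‖ ≤ C_u·F·e^{−κ·d_m(Πb₋, v)}` (DISPLAYED; supplied by this lineage's (EA0S)∕(ECL)), with `A = 2|η⁻¹|ΣB_ν`,
# `B = (2(|η⁻¹|(c_P + m_c) + dη⁻²(b′ + b²)) + |η⁻¹|b∕β)·ΣB_ν`, `b = 2M_φM_φ′ε_t`, `b′ = 2M_φM_φ′a_U`, `c_P` the constant of this lineage's
# `B9Eq326LocalPartTowerZerothOrderCoshRow` at `κ := η⁻²`** — the bond-operator twin of the NE9 OWNER t4-ne9-p1's (GT)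
# `B9Eq342GreenPrimeTowerGradientRow.norm_covDeriv_GpOfUk_le_blockLetter` and the tower twin of ne9-leaf-05's (K55)∕(K57) §1
# (`B9Eq326LocalPartDivergenceBlockLetterSmallGauge`, `B9Eq326LocalPartDivergenceBlockLetterClosed.norm_covDivL2K_localInv_le_blockLetter`); the OWNER's
# PRE-INTENT-6 (DVT), journal l.65114, taken by this seat l.65169; consumer named there: the VALUE member of [Balaban1985Variational] (117) for `𝔊̃_k`, whose
# middle term reads `D*_UG₁,k = D*_UA₀,k⁻¹ + …` by this lineage's `B9Eq326WoodburySchurTower.G1k_eq_woodbury`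

statement-level skeleton of published theorems with citation tags; proofs where landed; nothing here is a claim about the Yang–Mills mass gap

CITATION HEADER (lean-in-tree rule).  Audit cell `pub-balaban`, sub-cell `t4`, BINDER row NE9; filed by NE9 crux-team LEAF PROVER 03 (`b2b-balaban-t4-ne9-formalise-leaf-03`,
gen 79; road ΔA-CT).  Imports ne9-leaf-05's (K48) `B9Eq326LocalPartDivergenceRow` (storey J's t-free divergence row of a solution of `L_K u + P u = f` on a
generic torus `TSite d N`; through it (K41) `B9Eq342GradientRowAssembly`, (K42) `B9Eq326LocalPartSliceEquation`, (K46) `B9Eq38CovDivSliceGradient`, (K38)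
`B9Eq342GradientRowNaturalPerturbation`), the OWNER's (GT) `B9Eq342GreenPrimeTowerGradientRow` (§0: the tower's big-block currency; through it (K54)
`B9Eq342GradientRowSmallGaugeLetters`, `B9Eq342CoshWeightSite`), and this lineage's `B9Eq326LocalPartTowerZerothOrderCoshRow` (the `hPuv` slot at the
tower; through it `B9Eq326LocalPartKatoForm`, (ECL), (PSK), (K59)).  SOURCE READ first-hand in the held text layer [Balaban1985BackgroundPropagators]
(`paper:balaban1985-cmp99-background-propagators`, journal page = PDF page + 388): p. 397 Thm 3.1 *«There exist positive constants M₁, δ₀, α₀, B₀ dependent on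
d and L only …»* and (3.42); p. 395 (3.26) *«Δ_a(U) = Δ(U) + D_UR(U)D*_U + Q*(U)aQ(U)»*; p. 392 (3.8) (the covariant divergence `D*_U`); p. 394 (3.23);
p. 399 (3.49); pp. 404–405 (3.69)–(3.73) (the weighted sup-norm step); [Balaban1985Variational] p. 298 (134)–(136).  Print proves the gradient rows by the
random walk of Sect. 3 pp. 398–409 over the cubes of (3.35); the cell's road is storey J (a weighted sup-norm contraction; t4-ne9-idea-1, ne9-leaf-05 (K41)) on
top of this lineage's Kato-domination value row of `A₀,k⁻¹` — [folklore] composition BY NAME of tree theorems; NOTHING of print's proof is reproduced; nothing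
printed is a hypothesis except the model letters; the `[cite: …]` tags are TEXT LOCATIONS.

WHAT IS PROVED (sorry-free; proof lane — 0 `def`; [folklore]).
* §1 **`norm_covDivL2K_le_bigBlockLetter_smallGauge`** — storey J's divergence row AT THE TOWER, generic order-zero part `P`, small-gauge model (tower twin of
  (K55)): (K48) `norm_covDivL2K_le_weighted_uniform` at `N := towerP L m (n+1)`, centre `x₀ := y`, comparison gauge `g ≡ 1` and cutoff `χ ≡ 1` ((K54)
  `inner_AdW_one`, `norm_sub_pureGauge_le`, `norm_rel_sub_le`, `norm_inv_sub_le`, `norm_covDiff_le`; `c∕r = c∕r² = 0`, `Ω = univ`), the data ∕ value rows in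
  (GT) §0's big-block currency per direction (`weighted_row_of_bigBlock_support`, `weighted_row_of_bigBlock_decay`), the `hPuv` slot displayed,
  `W_y(y) = 1` (`B9Eq342CoshWeightSite.weight_site_centre`).
* §2 **`norm_covDivL2K_localInvK_le_bigBlockLetter`** — THE ROW above for `u := A₀,k⁻¹f` (`B11Eq103H1Complex.greenK` ∕ `apply_greenK`): §1 at `t := η⁻¹`,
  `P := Δ′ + Q_k†(a•Q_k) − η⁻²𝒦` by `B9Eq326LocalPartKatoForm.localPart_eq_kato_add`, `hPuv :=`
  `B9Eq326LocalPartTowerZerothOrderCoshRow.norm_zerothOrder_apply_le_weighted_cosh_tower`.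
HONEST SCOPE.  Composition BY NAME; DISPLAYED: the decayed value row (`C_u`, `κ ≤ θL^{n+1}` — (EA0S) `B9Eq326LocalPartTowerSupDecay.norm_localInvK_apply_le_decay`
∕ (ECL) supply it, not composed here), (T) contractions, the big-block family `P_y`, the MODEL letters (`U(b) ∈ U1`, `‖U(b) − 1‖ ≤ ε_t`, the bond-gradient datum
`a_U` — NOT derivable from `ε_t` and the plaquette letters, cf. the OWNER's CONSUMER NOTE in (GT) —, the plaquette letters `δ`, the `Q_k` regularity letters,
the diagonal `c₀(L^{n+1})^d = c₁`), storey J's windows (`θ`, `m_c`, `β`, `κ′`, `C`, `K`); every constant symbolic and crude; the tower-specific letters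
`e^{θ(L^{n+1}−1)}`, `e^{θd(2L^{n+1}−1)}`, `√(c₀·d·(L^{n+1})^d)∕√c₁`, `|η⁻¹|ε_t`, `η⁻²a_U`, `|η⁻¹|B_ν`, `|η⁻¹|b∕β` are displayed as they fall — height-free at
`θ = κ₀η`, `ε_t = αη`, `a_U = α′η²`, `β := 2 sinh θ∕(m_c − 2dη⁻²(cosh θ − 1))` on print's diagonal `ηL^{n+1} = 1` exactly as the OWNER's
`B9Eq342GreenPrimeTowerGradientRowDiagonal` reads the site twin (the companion closing, not here); the transposed row `A₀,k⁻¹D_U` is NOT here ((K58)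
`B9Eq326LocalPartGradientRowAdjoint.transposed_blockLetter` reads it from §2 by duality); nothing of [B9] Thm 3.1∕3.3∕3.11 is asserted, valued or discharged.
NOT NE9 (cell pub-balaban: NE9 NOT PRINTED ∕ NOT PROVED; «NE9 ⇐ the named binders»; row WALLED ON A MODEL (O-NE9-1; #5 UNRULED); spine PROVED 0∕9; rung (B)+1 on a
finite T⁴ — NOT infinite volume, NOT mass gap, NOT BetaPertH, NOT Clay; HONEST DEPENDENCY: continuum YM on T⁴ ⇐ BetaPertH ∧ nine spine estimates (0/9 proved);
BetaPertH ⇐ (D1) ∧ (D4) ∧ CAP+tail; G-an2-4 gates asym, D1 and NE2/3/4).  NEW file; nothing modified.  Net new unproved facts: 0.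
-/

noncomputable section

set_option autoImplicit false

open scoped BigOperators InnerProductSpace

namespace Literature.MathematicalPhysics.QuantumFieldTheory.Balaban1983to89.B9Eq326LocalPartTowerDivergenceRow

open B4Sect5Torus (TSite tdist)
open B4TorusKernel.MultiPeriod (circAbs)
open B9SectCLatticeCarrier (Bond DirPair bpos btgt shift unshift)
open B9Eq311L2Pairing (WL2)
open B11Eq103H1Complex (BondL2K covDivL2K covDerivL2K greenK apply_greenK)
open B9Eq310HessianOperator (adTransportW curvOp hessOp)
open B9Eq310DeltaPrime (reHol imHol)
open B7Prop1Explicit (U1 Wcx boxVec)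
open B9Eq319QprimeTorus (fineP blockCoord)
open B9Eq315QTorus (perCfg cornerSite)
open B9Eq315QTower (towerP UlevOf)
open B9Eq316TowerFlatIsOneStep (towerP_eq_fineP_pow siteCast)
open B9Eq326OperatorTower (QkW)
open B9Eq328GaugeAction (gaugeU)
open B9Eq326LocalPartKatoForm (bondLapK weitzOpK localPart_eq_kato_add)
open B9Eq326LocalPartDivergenceRow (norm_covDivL2K_le_weighted_uniform)
open B9Eq331PureGaugeResolventConjugation (adTransportW_inv_adTransportW)
open B9Eq342GradientRowSmallGaugeLetters (inner_AdW_one norm_sub_pureGauge_le norm_rel_sub_le norm_inv_sub_le norm_covDiff_le)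
open B9Eq342CoshWeightSite (weight_site_centre)
open B9Eq342GreenPrimeTowerGradientRow (weighted_row_of_bigBlock_decay weighted_row_of_bigBlock_support)
open B9Eq326LocalPartTowerZerothOrderCoshRow (norm_zerothOrder_apply_le_weighted_cosh_tower)

/-! ## §1 Storey J's divergence row at the tower, small-gauge model, generic order-zero part -/

section Generic

variable {d : ℕ} (L : ℕ) [NeZero L] (m : Fin d → ℕ) [∀ i, NeZero (m i)] (n : ℕ)
  {𝔸 : Type*} [NormedRing 𝔸] [NormedAlgebra ℂ 𝔸] [NormOneClass 𝔸]
  {W : Type*} [NormedAddCommGroup W] [InnerProductSpace ℂ W] [FiniteDimensional ℂ W] (φ : W ≃ₗ[ℂ] 𝔸) {Mφ Mφ' : ℝ}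
  (hφ : ∀ w, ‖φ w‖ ≤ Mφ * ‖w‖) (hφ' : ∀ X, ‖φ.symm X‖ ≤ Mφ' * ‖X‖) (hMφ : 0 ≤ Mφ) (hMφ' : 0 ≤ Mφ')
  {c₀ : ℝ} [Fact (0 < c₀)] (t mm θ : ℝ) (hmm : 0 < mm)
  (U : Bond d (towerP L m (n + 1)) → 𝔸ˣ) (hU1 : ∀ b, U b ∈ U1 𝔸) {εU aU : ℝ} (hεU : 0 ≤ εU) (haU : 0 ≤ aU)
  (hUε : ∀ b, ‖(U b : 𝔸) - 1‖ ≤ εU)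
  (hUa : ∀ (x : TSite d (towerP L m (n + 1))) (μ : Fin d), ‖(U (x, μ) : 𝔸) - (U (unshift μ x, μ) : 𝔸)‖ ≤ aU)


include hφ hφ' hMφ hMφ' hmm hU1 hεU haU hUε hUa in
/-- **STOREY J's DIVERGENCE ROW AT THE TOWER, SMALL-GAUGE MODEL, GENERIC ORDER-ZERO PART** (the tower twin of ne9-leaf-05's (K55)
`B9Eq326LocalPartDivergenceBlockLetterSmallGauge.norm_covDivL2K_le_blockLetter_smallGauge`, in the big-block currency of the OWNER's (GT) §0).  On the bonds of
`T_{(L^{n+1}m)}`: a background with `U(b) ∈ U1`, `‖U(b) − 1‖ ≤ ε_U` and the bond-gradient datum `‖U(x,μ) − U(x−e_μ,μ)‖ ≤ a_U`; (T) contractive transporters; a bond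
equation `L_K u + P u = f` (`L_K = bondLapK t (Ad U) (Ad U⁻¹)`, `P` ANY linear map); a source `f` supported over the bonds of ONE big block `v` with `‖f(b)‖ ≤ F`;
the decayed value row `‖u(b)‖ ≤ C_u·F·e^{−κ·d_m(Πb₋, v)}` (`0 ≤ κ ≤ θL^{n+1}`); the order-zero implication `hPuv` (for every centre the value row carries to a
`P`-row with the constant `c_P`); a site rate `θ ≥ 0`, a comparison mass `m_c > 2dt²(cosh θ − 1)` and the t-free windows of (K41) §4 (`0 < β ≤ B_ν`,
`|t|B_ν ≤ C ≤ K∕√m_c`, `θ ≤ κ′`, `2(|t|·2M_φM_φ′ε_U)(e^{κ′}+1)dK ≤ √m_c`).  THEN at every fine site `y`: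
`‖(D*_U u)(y)‖ ≤ 2e^{θ(L^{n+1}−1)}·((2|t|ΣB_ν) + (2(|t|((c_P + m_c) + dt²(b′ + b²)) + |t|b∕β)·ΣB_ν·C_u)·F·e^{−κ·d_m(Πy, v)}`, `b = 2M_φM_φ′ε_U`,
`b′ = 2M_φM_φ′a_U` — (K48) `norm_covDivL2K_le_weighted_uniform` (generic `TSite d N`) at `N := towerP L m (n+1)`, centre `x₀ := y`, comparison gauge
`g ≡ 1` and cutoff `χ ≡ 1` ((K54)), the three weighted rows by (GT) §0 per direction, `W_y(y) = 1`. [folklore]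
[cite: Balaban1985BackgroundPropagators, Thm 3.1 (3.42) p.397, (3.8) p.392, (3.26) p.395, (3.35) p.396, (3.49) p.399, (3.70)–(3.73) pp.404–405] -/
theorem norm_covDivL2K_le_bigBlockLetter_smallGauge (ht : 0 < t) (hθ : 0 ≤ θ) (hlam : 2 * (d : ℝ) * t ^ 2 * (Real.cosh θ - 1) < mm)
    (hn : ∀ ν, 2 ≤ towerP L m (n + 1) ν)
    (hR : ∀ (b : Bond d (towerP L m (n + 1))) (w : W), ‖adTransportW φ U b w‖ ≤ ‖w‖)
    (hS : ∀ (b : Bond d (towerP L m (n + 1))) (w : W), ‖adTransportW φ (fun bb => (U bb)⁻¹) b w‖ ≤ ‖w‖)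
    (P : BondL2K ℂ d (towerP L m (n + 1)) c₀ W →ₗ[ℂ] BondL2K ℂ d (towerP L m (n + 1)) c₀ W) (u f : BondL2K ℂ d (towerP L m (n + 1)) c₀ W)
    (hu : bondLapK ℂ c₀ (t : ℂ) (adTransportW φ U) (adTransportW φ fun bb => (U bb)⁻¹) u + P u = f)
    (v : TSite d m) {F Cu κ cP : ℝ} (hF : 0 ≤ F) (hCu : 0 ≤ Cu) (hκ : 0 ≤ κ) (hκθ : κ ≤ θ * (L : ℝ) ^ (n + 1)) (hcP : 0 ≤ cP)
    (hfv : ∀ b : Bond d (towerP L m (n + 1)), blockCoord (L ^ (n + 1)) m (siteCast (towerP_eq_fineP_pow L m (n + 1)) b.1) ≠ v → WL2.equiv ℂ (fun _ : Bond d (towerP L m (n + 1)) => c₀) W f b = 0)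
    (hfF : ∀ b : Bond d (towerP L m (n + 1)), ‖WL2.equiv ℂ (fun _ : Bond d (towerP L m (n + 1)) => c₀) W f b‖ ≤ F)
    (hudec : ∀ b : Bond d (towerP L m (n + 1)), ‖WL2.equiv ℂ (fun _ : Bond d (towerP L m (n + 1)) => c₀) W u b‖ ≤
      Cu * F * Real.exp (-(κ * tdist m (blockCoord (L ^ (n + 1)) m (siteCast (towerP_eq_fineP_pow L m (n + 1)) b.1)) v)))
    (hPuv : ∀ (y : TSite d (towerP L m (n + 1))) (Nu : ℝ), 0 ≤ Nu →
      (∀ b : Bond d (towerP L m (n + 1)), ‖WL2.equiv ℂ (fun _ : Bond d (towerP L m (n + 1)) => c₀) W u b‖ ≤ Nu *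
          (fun x : TSite d (towerP L m (n + 1)) => ∏ μ, Real.cosh (θ * (circAbs (towerP L m (n + 1) μ)
            (ZMod.val (((y μ : ℕ) : ZMod (towerP L m (n + 1) μ)) - ((x μ : ℕ) : ZMod (towerP L m (n + 1) μ)))) : ℝ))) b.1) →
      ∀ b : Bond d (towerP L m (n + 1)), ‖WL2.equiv ℂ (fun _ : Bond d (towerP L m (n + 1)) => c₀) W (P u) b‖ ≤ (cP * Nu) *
          (fun x : TSite d (towerP L m (n + 1)) => ∏ μ, Real.cosh (θ * (circAbs (towerP L m (n + 1) μ)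
            (ZMod.val (((y μ : ℕ) : ZMod (towerP L m (n + 1) μ)) - ((x μ : ℕ) : ZMod (towerP L m (n + 1) μ)))) : ℝ))) b.1)
    {β : ℝ} (hβ : 0 < β) (hβB : ∀ ν, β ≤ (fun ν : Fin d => (1 + Real.exp (-θ)) *
    ((1 + 2 * t / (towerP L m (n + 1) ν * Real.sqrt (mm - 2 * ((d : ℝ) - 1) * t ^ 2 * (Real.cosh θ - 1)))) /
      Real.sqrt ((mm - 2 * ((d : ℝ) - 1) * t ^ 2 * (Real.cosh θ - 1)) ^ 2 + 4 * (mm - 2 * ((d : ℝ) - 1) * t ^ 2 * (Real.cosh θ - 1)) * t ^ 2)) +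
    2 * Real.sinh θ / (mm - 2 * (d : ℝ) * t ^ 2 * (Real.cosh θ - 1))) ν) {κ' C K : ℝ} (hθκ : θ ≤ κ') (hC : 0 ≤ C) (htB : ∀ ν, ‖(t : ℂ)‖ * (fun ν : Fin d => (1 + Real.exp (-θ)) *
    ((1 + 2 * t / (towerP L m (n + 1) ν * Real.sqrt (mm - 2 * ((d : ℝ) - 1) * t ^ 2 * (Real.cosh θ - 1)))) /
      Real.sqrt ((mm - 2 * ((d : ℝ) - 1) * t ^ 2 * (Real.cosh θ - 1)) ^ 2 + 4 * (mm - 2 * ((d : ℝ) - 1) * t ^ 2 * (Real.cosh θ - 1)) * t ^ 2)) +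
    2 * Real.sinh θ / (mm - 2 * (d : ℝ) * t ^ 2 * (Real.cosh θ - 1))) ν ≤ C)
    (hCK : C ≤ K / Real.sqrt mm) (hmK : 2 * ((|t| * (2 * Mφ * Mφ' * εU)) * (Real.exp κ' + 1) * (d : ℝ) * K) ≤ Real.sqrt mm)
    (y : TSite d (towerP L m (n + 1))) :
    ‖WL2.equiv ℂ (fun _ : TSite d (towerP L m (n + 1)) => c₀) W (covDivL2K ℂ c₀ (t : ℂ) (adTransportW φ fun bb => (U bb)⁻¹) u) y‖ ≤
      2 * Real.exp (θ * ((L : ℝ) ^ (n + 1) - 1)) *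
        ((2 * ‖(t : ℂ)‖ * ∑ ν, (fun ν : Fin d => (1 + Real.exp (-θ)) *
    ((1 + 2 * t / (towerP L m (n + 1) ν * Real.sqrt (mm - 2 * ((d : ℝ) - 1) * t ^ 2 * (Real.cosh θ - 1)))) /
      Real.sqrt ((mm - 2 * ((d : ℝ) - 1) * t ^ 2 * (Real.cosh θ - 1)) ^ 2 + 4 * (mm - 2 * ((d : ℝ) - 1) * t ^ 2 * (Real.cosh θ - 1)) * t ^ 2)) +
    2 * Real.sinh θ / (mm - 2 * (d : ℝ) * t ^ 2 * (Real.cosh θ - 1))) ν) +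
          (2 * (‖(t : ℂ)‖ * ((cP + ‖((mm : ℝ) : ℂ)‖) +
              (d : ℝ) * (t ^ 2 * (2 * Mφ * Mφ' * aU + (2 * Mφ * Mφ' * εU) * (2 * Mφ * Mφ' * εU)))) + |t| * (2 * Mφ * Mφ' * εU) / β) *
            (∑ ν, (fun ν : Fin d => (1 + Real.exp (-θ)) *
    ((1 + 2 * t / (towerP L m (n + 1) ν * Real.sqrt (mm - 2 * ((d : ℝ) - 1) * t ^ 2 * (Real.cosh θ - 1)))) /
      Real.sqrt ((mm - 2 * ((d : ℝ) - 1) * t ^ 2 * (Real.cosh θ - 1)) ^ 2 + 4 * (mm - 2 * ((d : ℝ) - 1) * t ^ 2 * (Real.cosh θ - 1)) * t ^ 2)) +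
    2 * Real.sinh θ / (mm - 2 * (d : ℝ) * t ^ 2 * (Real.cosh θ - 1))) ν) * Cu)) * F * Real.exp (-(κ * tdist m (blockCoord (L ^ (n + 1)) m (siteCast (towerP_eq_fineP_pow L m (n + 1)) y)) v)) := by
  -- the common factor `M′ = 2e^{θ(L^{n+1}−1)}` and the decay `E = e^{−κ·d_m(Πy, v)}` at the centre `y`
  have hM'0 : 0 ≤ 2 * Real.exp (θ * ((L : ℝ) ^ (n + 1) - 1)) := by positivity
  have hE0 : 0 ≤ Real.exp (-(κ * tdist m (blockCoord (L ^ (n + 1)) m (siteCast (towerP_eq_fineP_pow L m (n + 1)) y)) v)) := (Real.exp_pos _).le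
  -- (DATA) the source row `Γ` at the centre `y`, per direction
  have hf' : ∀ b : Bond d (towerP L m (n + 1)), ‖WL2.equiv ℂ (fun _ : Bond d (towerP L m (n + 1)) => c₀) W f b‖ ≤
      (2 * Real.exp (θ * ((L : ℝ) ^ (n + 1) - 1)) * F * Real.exp (-(κ * tdist m (blockCoord (L ^ (n + 1)) m (siteCast (towerP_eq_fineP_pow L m (n + 1)) y)) v))) *
          (fun x : TSite d (towerP L m (n + 1)) => ∏ μ, Real.cosh (θ * (circAbs (towerP L m (n + 1) μ)
            (ZMod.val (((y μ : ℕ) : ZMod (towerP L m (n + 1) μ)) - ((x μ : ℕ) : ZMod (towerP L m (n + 1) μ)))) : ℝ))) b.1 := fun b =>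
    weighted_row_of_bigBlock_support L m n (fun x => WL2.equiv ℂ (fun _ : Bond d (towerP L m (n + 1)) => c₀) W f (x, b.2)) v
      hθ hF hκ hκθ (fun x hx => hfv (x, b.2) hx) (fun x => hfF (x, b.2)) y b.1
  -- (VALUE) the decayed value row `N_u` at the centre `y`, per direction
  have hval : ∀ b : Bond d (towerP L m (n + 1)), ‖WL2.equiv ℂ (fun _ : Bond d (towerP L m (n + 1)) => c₀) W u b‖ ≤
      (2 * Real.exp (θ * ((L : ℝ) ^ (n + 1) - 1)) * (Cu * F) * Real.exp (-(κ * tdist m (blockCoord (L ^ (n + 1)) m (siteCast (towerP_eq_fineP_pow L m (n + 1)) y)) v))) *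
          (fun x : TSite d (towerP L m (n + 1)) => ∏ μ, Real.cosh (θ * (circAbs (towerP L m (n + 1) μ)
            (ZMod.val (((y μ : ℕ) : ZMod (towerP L m (n + 1) μ)) - ((x μ : ℕ) : ZMod (towerP L m (n + 1) μ)))) : ℝ))) b.1 := fun b =>
    weighted_row_of_bigBlock_decay L m n (fun x => WL2.equiv ℂ (fun _ : Bond d (towerP L m (n + 1)) => c₀) W u (x, b.2)) v
      hθ (mul_nonneg hCu hF) hκ hκθ (fun x => hudec (x, b.2)) y b.1
  have hΓ : 0 ≤ 2 * Real.exp (θ * ((L : ℝ) ^ (n + 1) - 1)) * F * Real.exp (-(κ * tdist m (blockCoord (L ^ (n + 1)) m (siteCast (towerP_eq_fineP_pow L m (n + 1)) y)) v)) := by positivity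
  have hNu : 0 ≤ 2 * Real.exp (θ * ((L : ℝ) ^ (n + 1) - 1)) * (Cu * F) * Real.exp (-(κ * tdist m (blockCoord (L ^ (n + 1)) m (siteCast (towerP_eq_fineP_pow L m (n + 1)) y)) v)) := by positivity
  -- (ORDER ZERO) the `P`-row at the centre `y`
  have hPu := hPuv y _ hNu hval
  -- (K48) at the tower, comparison gauge `≡ 1`, cutoff `≡ 1`
  have hb0 : 0 ≤ 2 * Mφ * Mφ' * εU := by positivity
  have hb'0 : 0 ≤ 2 * Mφ * Mφ' * aU := by positivity
  have hmK' : 2 * ((((0 : ℝ) / 1 + |t| * (2 * Mφ * Mφ' * εU)) * (Real.exp κ' + 1) * (d : ℝ)) * K) ≤ Real.sqrt mm := by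
    rw [zero_div, zero_add]; simpa only [mul_assoc] using hmK
  have hmain := norm_covDivL2K_le_weighted_uniform φ t mm θ hmm y
    (fun _ : Bond d (towerP L m (n + 1)) => (1 : TSite d (towerP L m (n + 1)) → 𝔸ˣ)) (fun _ x w w' => inner_AdW_one φ x w w')
    ht hθ hlam hn (adTransportW φ U) (adTransportW φ fun bb => (U bb)⁻¹) (fun b w => adTransportW_inv_adTransportW φ U b w) hR hS
    P u f hu hΓ (mul_nonneg hcP hNu) hNu hf' hPu hval
    (fun (_ : Bond d (towerP L m (n + 1))) (_ : TSite d (towerP L m (n + 1))) => (1 : ℝ)) (fun _ _ => by simp) (fun _ => rfl) (fun _ => rfl)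
    (c := 0) (r := 1) (by norm_num) (by norm_num) (fun _ _ _ => by simp) (fun _ _ _ => by simp) (fun _ _ _ => by norm_num)
    (fun _ : Bond d (towerP L m (n + 1)) => (Set.univ : Set (TSite d (towerP L m (n + 1)))))
    (fun _ x hx => absurd (Set.mem_univ x) hx)
    hb0 hb0 hb'0 (fun b₀ w => norm_sub_pureGauge_le φ hφ hφ' hMφ' U hU1 hUε b₀ w)
    (fun _ x _ μ w => norm_rel_sub_le φ hφ hφ' hMφ' U hU1 hUε (x, μ) w)
    (fun _ x _ μ w => norm_rel_sub_le φ hφ hφ' hMφ' U hU1 hUε (unshift μ x, μ) w)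
    (fun _ x _ μ w => norm_inv_sub_le φ hφ hφ' hMφ' U hU1 hUε (unshift μ x, μ) w)
    (fun _ x _ μ w => norm_covDiff_le φ hφ hφ' hMφ hMφ' U hU1 hUa x μ w) hβ hβB hθκ hC htB hCK hmK' y
  -- read the output: `W_y(y) = 1`, the sum factors, the zero cutoff letters vanish
  have hcentre :
      (fun x : TSite d (towerP L m (n + 1)) => ∏ μ, Real.cosh (θ * (circAbs (towerP L m (n + 1) μ)
        (ZMod.val (((y μ : ℕ) : ZMod (towerP L m (n + 1) μ)) - ((x μ : ℕ) : ZMod (towerP L m (n + 1) μ)))) : ℝ))) y = 1 := weight_site_centre (towerP L m (n + 1)) θ y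
  rw [hcentre, mul_one, ← Finset.mul_sum] at hmain
  refine hmain.trans (le_of_eq ?_)
  simp only [zero_div, mul_zero, zero_mul, zero_add, add_zero]
  ring

end Generic

/-! ## §2 The divergence row of the tower local part `A₀,k⁻¹`, the value row displayed -/

section Instance

variable {d : ℕ} (L : ℕ) [NeZero L] (m : Fin d → ℕ) [∀ i, NeZero (m i)] (n : ℕ)
  {𝔸 : Type*} [NormedRing 𝔸] [StarRing 𝔸] [NormedAlgebra ℂ 𝔸] [StarModule ℂ 𝔸] [CompleteSpace 𝔸] [NormOneClass 𝔸]
  {W : Type*} [NormedAddCommGroup W] [InnerProductSpace ℂ W] [FiniteDimensional ℂ W] (φ : W ≃ₗ[ℂ] 𝔸) {c₀ c₁ : ℝ} [Fact (0 < c₀)] [Fact (0 < c₁)]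
  (U : Bond d (towerP L m (n + 1)) → 𝔸ˣ) (hL : 1 ≤ L) (α : ℕ → ℝ) (hα0 : ∀ j, 0 ≤ α j) (hα1 : ∀ j, α j ≤ 1 / 64)
  (hU1 : ∀ (j : ℕ) (x : B7Prop1Explicit.Site d) (k : Fin d), perCfg (towerP L m (j + 1)) (UlevOf L m (n + 1) U j) x k ∈ U1 𝔸)
  (hreg : ∀ (j : ℕ) (y : TSite d (towerP L m j)) (k : Fin d) (ρ : Fin d → Fin L),
    ‖((Wcx L (perCfg (towerP L m (j + 1)) (UlevOf L m (n + 1) U j)) (cornerSite L y) k (boxVec L ρ) : 𝔸ˣ) : 𝔸) - 1‖ ≤ α j)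
  {Mφ Mφ' : ℝ} (hMφ : 0 ≤ Mφ) (hφ : ∀ w, ‖φ w‖ ≤ Mφ * ‖w‖) (hMφ' : 0 ≤ Mφ') (hφ' : ∀ X, ‖φ.symm X‖ ≤ Mφ' * ‖X‖) (hstar : ∀ X : 𝔸, ‖star X‖ ≤ ‖X‖)
  (εU : ℕ → ℝ) (hεU : ∀ j, 0 ≤ εU j)
  (hUε : ∀ (j : ℕ) (b : Bond d (towerP L m (j + 1))), ‖(UlevOf L m (n + 1) U j b : 𝔸) - 1‖ ≤ εU j)
  {r εs : ℝ} (hr0 : 0 ≤ r) (hr1 : r < 1) (hεs : 0 ≤ εs) (hεg : ∀ j < n + 1, εU j ≤ εs * r ^ j)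
  (τ : 𝔸 →ₗ[ℂ] ℂ) {Mτ : ℝ} (hτ : ∀ X Y : 𝔸, ‖τ (X * Y)‖ ≤ Mτ * ‖X‖ * ‖Y‖) (hMτ : 0 ≤ Mτ)
  {η : ℝ} (hη : 0 < η) (hUb : ∀ b, U b ∈ U1 𝔸) {δ : ℝ} (hδ : 0 ≤ δ)
  (hRe : ∀ p : B9SectCLatticeCarrier.Plaq d (towerP L m (n + 1)), ‖reHol U p - 1‖ ≤ δ)
  (hIm : ∀ p : B9SectCLatticeCarrier.Plaq d (towerP L m (n + 1)), ‖imHol U p‖ ≤ δ)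
  {εt aU : ℝ} (hεt : 0 ≤ εt) (haU : 0 ≤ aU) (hUεt : ∀ b, ‖(U b : 𝔸) - 1‖ ≤ εt)
  (hUa : ∀ (x : TSite d (towerP L m (n + 1))) (μ : Fin d), ‖(U (x, μ) : 𝔸) - (U (unshift μ x, μ) : 𝔸)‖ ≤ aU)
  {PB : TSite d m → BondL2K ℂ d (towerP L m (n + 1)) c₀ W →L[ℂ] BondL2K ℂ d (towerP L m (n + 1)) c₀ W}
  (hPB : ∀ (y : TSite d m) (f : BondL2K ℂ d (towerP L m (n + 1)) c₀ W) (b : Bond d (towerP L m (n + 1))),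
    WL2.equiv ℂ (fun _ : Bond d (towerP L m (n + 1)) => c₀) W (PB y f) b =
      if blockCoord (L ^ (n + 1)) m (siteCast (towerP_eq_fineP_pow L m (n + 1)) b.1) = y then
        WL2.equiv ℂ (fun _ : Bond d (towerP L m (n + 1)) => c₀) W f b else 0)
  (mm θ : ℝ) (hmm : 0 < mm)


include hα0 hMφ hφ hMφ' hφ' hstar hεU hUε hr0 hr1 hεs hεg hτ hMτ hη hUb hδ hRe hIm hεt haU hUεt hUa hPB hmm in
/-- **THE DIVERGENCE ROW OF THE TOWER LOCAL PART `D*_U A₀,k⁻¹`, THE VALUE ROW DISPLAYED** (tower twin of ne9-leaf-05's (K57) §1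
`B9Eq326LocalPartDivergenceBlockLetterClosed.norm_covDivL2K_localInv_le_blockLetter`; bond-operator twin of the OWNER's (GT)
`B9Eq342GreenPrimeTowerGradientRow.norm_covDeriv_GpOfUk_le_blockLetter`).  On the bonds of `T_{(L^{n+1}m)}` (`1 ≤ m_i`, `1 ≤ d`, `N_ν ≥ 2`): the tower local
part `A₀ = Δ(U) + D_UD*_U + Q_k(U)†(a•Q_k(U))` (`Q_k := QkW`, `hA₀` as in (EA0S)∕(WST)) positive (`hpos₀`); the MODEL letters (`U(b) ∈ U1`, `‖U(b) − 1‖ ≤ ε_t`,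
the bond-gradient datum `a_U`, the plaquette letters `δ`, the `Q_k` regularity letters with the loop window `Σ_{j<n+1}α_j ≤ A_Q` and the geometric bond window,
the diagonal `c₀(L^{n+1})^d = c₁`); (T) contractive transporters; the big-block family `P_y` (`hPB`); a source `f` supported over the bonds of ONE big block `v`
with `‖f(b)‖ ≤ F`; THE DECAYED VALUE ROW `‖(A₀⁻¹f)(b)‖ ≤ C_u·F·e^{−κ·d_m(Πb₋, v)}`, `0 ≤ κ ≤ θL^{n+1}` (DISPLAYED — its supplier is this lineage's (EA0S)
`B9Eq326LocalPartTowerSupDecay.norm_localInvK_apply_le_decay` ∕ (ECL)); storey J's `cosh` currency (rate `θ ≥ 0`, comparison mass `m_c > 2dη⁻²(cosh θ − 1)`,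
windows `0 < β ≤ B_ν`, `θ ≤ κ′`, `‖η⁻¹‖B_ν ≤ C ≤ K∕√m_c`, `2(|η⁻¹|·2M_φM_φ′ε_t)(e^{κ′}+1)dK ≤ √m_c`).  THEN at every fine site `y`:
`‖(D*_U(A₀⁻¹f))(y)‖ ≤ 2e^{θ(L^{n+1}−1)}·((2‖η⁻¹‖ΣB_ν) + (2(‖η⁻¹‖((c_P + m_c) + dη⁻²(b′ + b²)) + |η⁻¹|b∕β)·ΣB_ν·C_u)·F·e^{−κ·d_m(Πy, v)}`, `b = 2M_φM_φ′ε_t`,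
`b′ = 2M_φM_φ′a_U`, `c_P` the constant of `B9Eq326LocalPartTowerZerothOrderCoshRow.norm_zerothOrder_apply_le_weighted_cosh_tower` at `κ := η⁻²` — §1 at `t := η⁻¹`,
`P := Δ′ + Q_k†(a•Q_k) − η⁻²𝒦` (`B9Eq326LocalPartKatoForm.localPart_eq_kato_add` at `u := A₀⁻¹f`, `apply_greenK`), `hPuv` := that row.  Every letter but `e^{θ(L^{n+1}−1)}`, `e^{θd(2L^{n+1}−1)}` and
`√(c₀·d·(L^{n+1})^d)∕√c₁` is the one-step letter verbatim; those three are height-free at `θ = κ₀η` on the diagonal (the companion closing).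
[cite: Balaban1985BackgroundPropagators, Thm 3.1 (3.42) p.397, (3.26) p.395, (3.8) p.392, (3.23) p.394, (3.49) p.399, (3.69)–(3.73) pp.404–405, Thm 3.11 p.416;
Balaban1985Variational, (134)–(136) p.298; Balaban1984PropagatorsI, p.36] -/
theorem norm_covDivL2K_localInvK_le_bigBlockLetter [DecidableEq (Bond d (towerP L m (n + 1)))] (hm : ∀ i, 1 ≤ m i) (hd : 1 ≤ d)
    (hn : ∀ ν, 2 ≤ towerP L m (n + 1) ν)
    (hR : ∀ (b : Bond d (towerP L m (n + 1))) (w : W), ‖adTransportW φ U b w‖ ≤ ‖w‖)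
    (hS : ∀ (b : Bond d (towerP L m (n + 1))) (w : W), ‖adTransportW φ (fun bb => (U bb)⁻¹) b w‖ ≤ ‖w‖)
    (a : ℝ) (A₀ : BondL2K ℂ d (towerP L m (n + 1)) c₀ W →ₗ[ℂ] BondL2K ℂ d (towerP L m (n + 1)) c₀ W)
    (hA₀ : A₀ = hessOp φ η U τ + covDerivL2K ℂ c₀ ((η : ℂ))⁻¹ (adTransportW φ U) ∘ₗ covDivL2K ℂ c₀ ((η : ℂ))⁻¹ (adTransportW φ fun b => (U b)⁻¹) +
      LinearMap.adjoint (QkW L m n φ U hL α hα1 hU1 hreg (c₀ := c₀) (c₁ := c₁)) ∘ₗ ((a : ℂ) • QkW L m n φ U hL α hα1 hU1 hreg (c₀ := c₀) (c₁ := c₁)))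
    (hpos₀ : ∀ x : BondL2K ℂ d (towerP L m (n + 1)) c₀ W, x ≠ 0 → 0 < RCLike.re ⟪x, A₀ x⟫_ℂ)
    (hw : c₀ * ((L : ℝ) ^ (n + 1)) ^ d = c₁) {AQ : ℝ} (hAQ : ∑ j ∈ Finset.range (n + 1), α j ≤ AQ)
    (hθ : 0 ≤ θ) (hlam : 2 * (d : ℝ) * η⁻¹ ^ 2 * (Real.cosh θ - 1) < mm)
    (v : TSite d m) (f : BondL2K ℂ d (towerP L m (n + 1)) c₀ W) {F Cu κ : ℝ} (hF : 0 ≤ F) (hCu : 0 ≤ Cu) (hκ : 0 ≤ κ)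
    (hκθ : κ ≤ θ * (L : ℝ) ^ (n + 1))
    (hfv : ∀ b : Bond d (towerP L m (n + 1)), blockCoord (L ^ (n + 1)) m (siteCast (towerP_eq_fineP_pow L m (n + 1)) b.1) ≠ v → WL2.equiv ℂ (fun _ : Bond d (towerP L m (n + 1)) => c₀) W f b = 0)
    (hfF : ∀ b : Bond d (towerP L m (n + 1)), ‖WL2.equiv ℂ (fun _ : Bond d (towerP L m (n + 1)) => c₀) W f b‖ ≤ F)
    (hudec : ∀ b : Bond d (towerP L m (n + 1)), ‖WL2.equiv ℂ (fun _ : Bond d (towerP L m (n + 1)) => c₀) W (greenK A₀ hpos₀ f) b‖ ≤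
      Cu * F * Real.exp (-(κ * tdist m (blockCoord (L ^ (n + 1)) m (siteCast (towerP_eq_fineP_pow L m (n + 1)) b.1)) v)))
    {β : ℝ} (hβ : 0 < β) (hβB : ∀ ν, β ≤ (fun ν : Fin d => (1 + Real.exp (-θ)) *
    ((1 + 2 * η⁻¹ / (towerP L m (n + 1) ν * Real.sqrt (mm - 2 * ((d : ℝ) - 1) * η⁻¹ ^ 2 * (Real.cosh θ - 1)))) /
      Real.sqrt ((mm - 2 * ((d : ℝ) - 1) * η⁻¹ ^ 2 * (Real.cosh θ - 1)) ^ 2 + 4 * (mm - 2 * ((d : ℝ) - 1) * η⁻¹ ^ 2 * (Real.cosh θ - 1)) * η⁻¹ ^ 2)) +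
    2 * Real.sinh θ / (mm - 2 * (d : ℝ) * η⁻¹ ^ 2 * (Real.cosh θ - 1))) ν) {κ' C K : ℝ} (hθκ : θ ≤ κ') (hC : 0 ≤ C) (htB : ∀ ν, ‖((η⁻¹ : ℝ) : ℂ)‖ * (fun ν : Fin d => (1 + Real.exp (-θ)) *
    ((1 + 2 * η⁻¹ / (towerP L m (n + 1) ν * Real.sqrt (mm - 2 * ((d : ℝ) - 1) * η⁻¹ ^ 2 * (Real.cosh θ - 1)))) /
      Real.sqrt ((mm - 2 * ((d : ℝ) - 1) * η⁻¹ ^ 2 * (Real.cosh θ - 1)) ^ 2 + 4 * (mm - 2 * ((d : ℝ) - 1) * η⁻¹ ^ 2 * (Real.cosh θ - 1)) * η⁻¹ ^ 2)) +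
    2 * Real.sinh θ / (mm - 2 * (d : ℝ) * η⁻¹ ^ 2 * (Real.cosh θ - 1))) ν ≤ C)
    (hCK : C ≤ K / Real.sqrt mm) (hmK : 2 * ((|η⁻¹| * (2 * Mφ * Mφ' * εt)) * (Real.exp κ' + 1) * (d : ℝ) * K) ≤ Real.sqrt mm)
    (y : TSite d (towerP L m (n + 1))) :
    ‖WL2.equiv ℂ (fun _ : TSite d (towerP L m (n + 1)) => c₀) W
        (covDivL2K ℂ c₀ ((η : ℂ))⁻¹ (adTransportW φ fun bb => (U bb)⁻¹) (greenK A₀ hpos₀ f)) y‖ ≤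
      2 * Real.exp (θ * ((L : ℝ) ^ (n + 1) - 1)) *
        ((2 * ‖((η⁻¹ : ℝ) : ℂ)‖ * ∑ ν, (fun ν : Fin d => (1 + Real.exp (-θ)) *
    ((1 + 2 * η⁻¹ / (towerP L m (n + 1) ν * Real.sqrt (mm - 2 * ((d : ℝ) - 1) * η⁻¹ ^ 2 * (Real.cosh θ - 1)))) /
      Real.sqrt ((mm - 2 * ((d : ℝ) - 1) * η⁻¹ ^ 2 * (Real.cosh θ - 1)) ^ 2 + 4 * (mm - 2 * ((d : ℝ) - 1) * η⁻¹ ^ 2 * (Real.cosh θ - 1)) * η⁻¹ ^ 2)) +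
    2 * Real.sinh θ / (mm - 2 * (d : ℝ) * η⁻¹ ^ 2 * (Real.cosh θ - 1))) ν) +
          (2 * (‖((η⁻¹ : ℝ) : ℂ)‖ * ((
              (768 * Fintype.card (DirPair d) * Mτ * Mφ ^ 2 * (‖((η : ℂ)) ^ d‖ / c₀) * ‖((η : ℂ))⁻¹‖ ^ 2 * δ * Real.exp θ ^ 2 +
                |a| * (Mφ' * Mφ * Real.exp (100 * d * (d + 1) * (L : ℝ) ^ d * AQ) * ((2 * d : ℕ) : ℝ) *
                  ((Mφ' * Mφ * Real.exp (Real.sqrt ((L : ℝ) ^ d) * (Real.sqrt (2 * d) * (102 * (d + 1) ^ 2 * L)) * (εs / (1 - r)))) / Real.sqrt c₁ *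
                    (2 * ((Fintype.card (Option (Fin d × Bool)) : ℝ) * (Real.sqrt (c₀ * (d * ((L : ℝ) ^ (n + 1)) ^ d))))))) *
                  Real.exp (θ * (d : ℝ) * ((L : ℝ) ^ (n + 1) * 1 + ((L : ℝ) ^ (n + 1) - 1))) +
                ‖((η : ℂ))⁻¹ * ((η : ℂ))⁻¹‖ * ((d - 1 : ℝ) * (2 * Mφ * Mφ' * (2 * δ)) * Real.exp θ ^ 2)) + ‖((mm : ℝ) : ℂ)‖) +
              (d : ℝ) * (η⁻¹ ^ 2 * (2 * Mφ * Mφ' * aU + (2 * Mφ * Mφ' * εt) * (2 * Mφ * Mφ' * εt)))) + |η⁻¹| * (2 * Mφ * Mφ' * εt) / β) *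
            (∑ ν, (fun ν : Fin d => (1 + Real.exp (-θ)) *
    ((1 + 2 * η⁻¹ / (towerP L m (n + 1) ν * Real.sqrt (mm - 2 * ((d : ℝ) - 1) * η⁻¹ ^ 2 * (Real.cosh θ - 1)))) /
      Real.sqrt ((mm - 2 * ((d : ℝ) - 1) * η⁻¹ ^ 2 * (Real.cosh θ - 1)) ^ 2 + 4 * (mm - 2 * ((d : ℝ) - 1) * η⁻¹ ^ 2 * (Real.cosh θ - 1)) * η⁻¹ ^ 2)) +
    2 * Real.sinh θ / (mm - 2 * (d : ℝ) * η⁻¹ ^ 2 * (Real.cosh θ - 1))) ν) * Cu)) * F * Real.exp (-(κ * tdist m (blockCoord (L ^ (n + 1)) m (siteCast (towerP_eq_fineP_pow L m (n + 1)) y)) v)) := by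
  have ht : (0 : ℝ) < η⁻¹ := inv_pos.2 hη
  have hinv : ((η : ℂ))⁻¹ = ((η⁻¹ : ℝ) : ℂ) := (Complex.ofReal_inv η).symm
  have hd1 : (0 : ℝ) ≤ (d : ℝ) - 1 := sub_nonneg.mpr (by exact_mod_cast hd)
  have hc₀ : 0 < c₀ := Fact.out
  have hc₁ : 0 < c₁ := Fact.out
  -- the Kato form of `A₀` at `u := A₀⁻¹f`: `L_K u + P u = f`, `P = Δ′ + Q_k†(a•Q_k) − η⁻²𝒦`
  have hkato := localPart_eq_kato_add (hA₀ := hA₀)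
  have hu : bondLapK ℂ c₀ ((η⁻¹ : ℝ) : ℂ) (adTransportW φ U) (adTransportW φ fun b => (U b)⁻¹) (greenK A₀ hpos₀ f) +
      (curvOp φ τ η U + LinearMap.adjoint (QkW L m n φ U hL α hα1 hU1 hreg (c₀ := c₀) (c₁ := c₁)) ∘ₗ
            ((a : ℂ) • QkW L m n φ U hL α hα1 hU1 hreg (c₀ := c₀) (c₁ := c₁)) -
          (((η : ℂ))⁻¹ * ((η : ℂ))⁻¹) • weitzOpK ℂ c₀ (adTransportW φ U) (adTransportW φ fun b => (U b)⁻¹) :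
          BondL2K ℂ d (towerP L m (n + 1)) c₀ W →ₗ[ℂ] BondL2K ℂ d (towerP L m (n + 1)) c₀ W) (greenK A₀ hpos₀ f) = f := by
    rw [← hinv]
    have e : bondLapK ℂ c₀ ((η : ℂ))⁻¹ (adTransportW φ U) (adTransportW φ fun b => (U b)⁻¹) (greenK A₀ hpos₀ f) +
        (curvOp φ τ η U + LinearMap.adjoint (QkW L m n φ U hL α hα1 hU1 hreg (c₀ := c₀) (c₁ := c₁)) ∘ₗ
              ((a : ℂ) • QkW L m n φ U hL α hα1 hU1 hreg (c₀ := c₀) (c₁ := c₁)) -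
            (((η : ℂ))⁻¹ * ((η : ℂ))⁻¹) • weitzOpK ℂ c₀ (adTransportW φ U) (adTransportW φ fun b => (U b)⁻¹) :
            BondL2K ℂ d (towerP L m (n + 1)) c₀ W →ₗ[ℂ] BondL2K ℂ d (towerP L m (n + 1)) c₀ W) (greenK A₀ hpos₀ f) =
        ((bondLapK ℂ c₀ ((η : ℂ))⁻¹ (adTransportW φ U) (adTransportW φ fun b => (U b)⁻¹) +
            LinearMap.adjoint (QkW L m n φ U hL α hα1 hU1 hreg (c₀ := c₀) (c₁ := c₁)) ∘ₗ
              ((a : ℂ) • QkW L m n φ U hL α hα1 hU1 hreg (c₀ := c₀) (c₁ := c₁))) +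
          (curvOp φ τ η U - (((η : ℂ))⁻¹ * ((η : ℂ))⁻¹) • weitzOpK ℂ c₀ (adTransportW φ U) (adTransportW φ fun b => (U b)⁻¹)) :
            BondL2K ℂ d (towerP L m (n + 1)) c₀ W →ₗ[ℂ] BondL2K ℂ d (towerP L m (n + 1)) c₀ W) (greenK A₀ hpos₀ f) := by
      simp only [LinearMap.add_apply, LinearMap.sub_apply]
      abel
    rw [e, ← hkato]
    exact apply_greenK hpos₀ f
  -- the zeroth-order row of `B9Eq326LocalPartTowerZerothOrderCoshRow` as the `hPuv` slot, at `κ := η⁻²`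
  have hcP : 0 ≤ 768 * Fintype.card (DirPair d) * Mτ * Mφ ^ 2 * (‖((η : ℂ)) ^ d‖ / c₀) * ‖((η : ℂ))⁻¹‖ ^ 2 * δ * Real.exp θ ^ 2 +
      |a| * (Mφ' * Mφ * Real.exp (100 * d * (d + 1) * (L : ℝ) ^ d * AQ) * ((2 * d : ℕ) : ℝ) *
        ((Mφ' * Mφ * Real.exp (Real.sqrt ((L : ℝ) ^ d) * (Real.sqrt (2 * d) * (102 * (d + 1) ^ 2 * L)) * (εs / (1 - r)))) / Real.sqrt c₁ *
          (2 * ((Fintype.card (Option (Fin d × Bool)) : ℝ) * (Real.sqrt (c₀ * (d * ((L : ℝ) ^ (n + 1)) ^ d))))))) *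
        Real.exp (θ * (d : ℝ) * ((L : ℝ) ^ (n + 1) * 1 + ((L : ℝ) ^ (n + 1) - 1))) +
      ‖((η : ℂ))⁻¹ * ((η : ℂ))⁻¹‖ * ((d - 1 : ℝ) * (2 * Mφ * Mφ' * (2 * δ)) * Real.exp θ ^ 2) := by
    have h3 : 0 ≤ ‖((η : ℂ))⁻¹ * ((η : ℂ))⁻¹‖ * ((d - 1 : ℝ) * (2 * Mφ * Mφ' * (2 * δ)) * Real.exp θ ^ 2) :=
      mul_nonneg (norm_nonneg _) (mul_nonneg (mul_nonneg hd1 (by positivity)) (by positivity))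
    exact add_nonneg (add_nonneg (by positivity) (by positivity)) h3
  have h := norm_covDivL2K_le_bigBlockLetter_smallGauge L m n φ hφ hφ' hMφ hMφ' η⁻¹ mm θ hmm U hUb hεt haU hUεt hUa ht hθ hlam hn hR hS
    (curvOp φ τ η U + LinearMap.adjoint (QkW L m n φ U hL α hα1 hU1 hreg (c₀ := c₀) (c₁ := c₁)) ∘ₗ
          ((a : ℂ) • QkW L m n φ U hL α hα1 hU1 hreg (c₀ := c₀) (c₁ := c₁)) -
        (((η : ℂ))⁻¹ * ((η : ℂ))⁻¹) • weitzOpK ℂ c₀ (adTransportW φ U) (adTransportW φ fun b => (U b)⁻¹) :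
        BondL2K ℂ d (towerP L m (n + 1)) c₀ W →ₗ[ℂ] BondL2K ℂ d (towerP L m (n + 1)) c₀ W)
    (greenK A₀ hpos₀ f) f hu v hF hCu hκ hκθ hcP hfv hfF hudec
    (fun y' Nu hNu hv => norm_zerothOrder_apply_le_weighted_cosh_tower L m n φ U hL α hα0 hα1 hU1 hreg hMφ hφ hMφ' hφ' hstar εU hεU hUε hr0 hr1
      hεs hεg τ hτ hMτ η hUb hδ hRe hIm hPB θ hm hAQ hw hθ hR hS a (((η : ℂ))⁻¹ * ((η : ℂ))⁻¹) (greenK A₀ hpos₀ f) y' Nu hNu hv)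
    hβ hβB hθκ hC htB hCK hmK y
  have e2 : covDivL2K ℂ c₀ ((η : ℂ))⁻¹ (adTransportW φ fun b => (U b)⁻¹) =
      covDivL2K ℂ c₀ ((η⁻¹ : ℝ) : ℂ) (adTransportW φ fun b => (U b)⁻¹) := by rw [hinv]
  rw [e2]
  exact h

end Instance

end Literature.MathematicalPhysics.QuantumFieldTheory.Balaban1983to89.B9Eq326LocalPartTowerDivergenceRow

end
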